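import Literature.NumberTheory.Automorphic.AutomorphicRepGKComplexW
import Literature.NumberTheory.Automorphic.TwistedQuotientConeClass
import Literature.NumberTheory.Automorphic.ResGLnHermitianConeOpen
import Literature.NumberTheory.Automorphic.CentralDerivativesTranslationGL
import Literature.NumberTheory.Automorphic.HumbertFormsGoodCover
import Literature.NumberTheory.Automorphic.AutomorphicRepsGLCuspFormsSquareIntegrable
import Literature.NumberTheory.Automorphic.ResGLnCohomology
import Literature.NumberTheory.Automorphic.GL2CCoeffRepComplex
import HarnessLib

/-!
# The Borel–Wallach dictionary in the cone model: the `E_λ(ℂ)`-valued differential form of a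
# `(𝔤, K_∞)`-cochain with values in cusp functions (definitions and the algebraic identities)

Topic `NumberTheory/Automorphic`; namespace `Literature.NumberTheory.Automorphic.ConeDictionary`.
Definitions with bodies and theorems (no named fact, no `sorry`).

Let `π = W / W'` be an automorphic representation of `GL_n(𝔸_K)` (Borel–Jacquet model, `W` a space of
automorphic FUNCTIONS), `E = E_λ(ℂ) ⊗ ε_S` the archimedean coefficient representation
`ResGLnCohomology.archCoeffRepSign n K S λ` of `G_∞ = GL_n(K_∞)` and
`η : ∧^q 𝔤 →ₗ[ℝ] W ⊗ E` a `q`-cochain (an element of the `(𝔤, K_∞)`-complex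
`gkComplexLamSign`, `AutomorphicRepGKComplexW`).  Following [cite: BorelWallach2000, VII 2.2–2.5] we
attach to `η` and a finite-adelic point `c ∈ GL_n(𝔸_K^∞)`:

* `leftForm η c m` — the `E`-valued alternating `q`-form `Y ↦ E(m) · η(Y)(m, c)` on
  `M_n(K_∞)` (the values of `η` EVALUATED at the adelic point `(m, c)` and twisted by `E(m)`), for a
  matrix `m` read in `G_∞` (`GLn.archOfMatrix`, junk off the invertible matrices), made continuous by
  finite-dimensionality;
* `leftTrivForm η c m = leftForm η c m ∘ ∧^q(m⁻¹ ·)` — the LEFT-TRIVIALISED form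
  `ω̃(m)(Y₁, …) = E(m) η(m⁻¹Y₁, …)(m, c)` (`Ring.inverse`), the shape differentiated by the
  Maurer–Cartan identity (`stub_extDeriv_leftTrivialised` of the line `Sketch`);
* `coneForm η c H` — **the form on the hermitian cone**: `ω_c(H)(v₁, …) = ω̃(g)(½ v₁ g⁻ᴴ, …)` for
  ANY invertible `g` with `g gᴴ = H` (a fixed global choice `sec H`; `halfRight g : v ↦ ½ v g⁻ᴴ` is
  a right inverse of the differential `Y ↦ Y gᴴ + g Yᴴ` of `p : g ↦ g gᴴ` at `g`).

THIS FILE proves the ALGEBRAIC identities of the dictionary (no derivative is taken):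

* `apply_eq_zero_of_skew` — a cochain of the `(𝔤, K_∞)`-complex vanishes when one argument is
  skew-hermitian (`𝔨`-relativity); `twistedEval_mul_inclusion` — and its twisted evaluation is
  invariant under `(g, X) ↦ (g k, Ad(k⁻¹) X)`, `k ∈ K_∞` (`K_∞`-fixedness);
* `leftFormAlg_update_add_skew` — `leftForm` only sees the hermitian parts of its arguments;
* `leftFormAlg_mul_inclusion` — `E(g k) η(k⁻¹ Y k)(g k, c) = E(g) η(Y)(g, c)`.

The pullback identity `p^* ω = ω̃`, the independence of the section, equivariance, right invariance,
the Hecke eigen-property and the analytic half (smoothness, `dω = 0` from `dη = 0`) follow in the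
sequel files of the line.

All archimedean objects are typed through THE DATUM `𝒟 = AutomorphyDatum.gl n K hcpt` (`𝒟.arch` is
`archGroupGL n K` definitionally): `σS`, `σ𝔤S` are the coefficient representation and its differential
re-typed once over `𝒟.arch`, so that no statement mixes the two spellings.

## References

* A. Borel, N. Wallach, *Continuous cohomology, discrete subgroups, and representations of reductive
  groups*, 2nd ed. (2000), I §5.1, VII 2.2–2.5. [BorelWallach2000]
* A. Borel, H. Jacquet, Corvallis (1979), §4.1–4.6. [BorelJacquet1979]
-/

noncomputable section

namespace Literature.NumberTheory.Automorphic

open scoped TensorProduct MatrixGroups Classical _root_.Matrix _root_.Matrix.Norms.Operator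
open _root_.NumberField _root_.NumberField.mixedEmbedding RealMatrixGroup

-- Mathlib idiom (as in `GKModules`): commutator bracket on `Module.End` / matrix algebras
attribute [local instance 100] LieRing.ofAssociativeRing

namespace ConeDictionary

variable {n : ℕ} {K : Type} [Field K] [NumberField K] {hcpt : isCompact_glFiniteIntegralLevel n K}
  (π : AutomorphicRepData (AutomorphyDatum.gl n K hcpt))
  (S : Finset {w : InfinitePlace K // w.IsReal}) (lam : (K →+* ℂ) → Fin n → ℤ) {q : ℕ}

/-! ### The coefficient representation over the datum, the carrier of the complex -/

section Coeff

variable (hcpt)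

set_option maxHeartbeats 800000 in
-- one-time re-typing of `archCoeffRepSign` over `𝒟.arch = archGroupGL n K` (definitional)
/-- `E_λ(ℂ) ⊗ ε_S` as a representation of the archimedean group OF THE DATUM (definitionally
`ResGLnCohomology.archCoeffRepSign n K S λ`). [cite: Clozel1990, Lemme 3.14] -/
abbrev σS : Representation ℂ (AutomorphyDatum.gl n K hcpt).arch.carrier (ResGLnCohomology.CoeffModule ℂ n K lam) :=
  ResGLnCohomology.archCoeffRepSign n K S lam

set_option maxHeartbeats 800000 in
-- one-time re-typing of `archCoeffLie` over `𝒟.arch.lie` (definitional)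
/-- The Leibniz differential of `E_λ(ℂ)` over the Lie algebra OF THE DATUM (definitionally
`ResGLnCohomology.archCoeffLie n K λ`). [cite: BorelWallach2000, 0 §2.3] -/
abbrev σ𝔤S : (AutomorphyDatum.gl n K hcpt).arch.lie →ₗ⁅ℝ⁆ Module.End ℂ (ResGLnCohomology.CoeffModule ℂ n K lam) :=
  ResGLnCohomology.archCoeffLie n K lam

set_option maxHeartbeats 800000 in
-- one-time restriction to `K_∞` over the datum
/-- `E_λ(ℂ) ⊗ ε_S` restricted to `K_∞`, over the datum. [cite: Clozel1990, Lemme 3.14] -/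
abbrev σSK : Representation ℂ (AutomorphyDatum.gl n K hcpt).arch.maximalCompact (ResGLnCohomology.CoeffModule ℂ n K lam) :=
  restrictK (AutomorphyDatum.gl n K hcpt).arch (σS hcpt S lam)

end Coeff

set_option maxHeartbeats 800000 in
-- one-time re-typing of `isGKModule_archCoeffSign.ad_compat` over the datum (definitional)
/-- `(𝔤, K)`-compatibility of `(σS, σ𝔤S)`. [cite: BorelWallach2000, 0 §2.5] -/
theorem σS_ad_compat (k : (AutomorphyDatum.gl n K hcpt).arch.maximalCompact) (X : (AutomorphyDatum.gl n K hcpt).arch.lie) :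
    σSK hcpt S lam k ∘ₗ σ𝔤S hcpt lam X ∘ₗ σSK hcpt S lam k⁻¹ =
      σ𝔤S hcpt lam ((AutomorphyDatum.gl n K hcpt).arch.Ad
        (Subgroup.inclusion (AutomorphyDatum.gl n K hcpt).arch.maximalCompact_le_carrier k) X) :=
  (ResGLnCohomology.isGKModule_archCoeffSign n K S lam).ad_compat k X

/-- The value module `W ⊗_ℂ E_λ(ℂ)` of the complex, with the `𝔤`-module structure of the Leibniz
action (`GKCarrier`; as a TYPE it is `π.W ⊗[ℂ] CoeffModule ℂ n K λ`, and its real structure is the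
restriction of the complex one). [cite: BorelWallach2000, I §5.1] -/
abbrev Carrier : Type :=
  GKCarrier (AutomorphyDatum.gl n K hcpt).arch
    (GKTensor.lie (AutomorphyDatum.gl n K hcpt).arch π.lieRepW (σ𝔤S hcpt lam))

/-- The `q`-cochains `∧^q 𝔤 →ₗ[ℝ] W ⊗ E_λ(ℂ)` of the complex. [cite: BorelWallach2000, I §5.1 (1)] -/
abbrev Cochain (q : ℕ) : Type :=
  Literature.Algebra.Lie.ChevalleyEilenberg.Cochain ℝ (AutomorphyDatum.gl n K hcpt).arch.lie (Carrier π lam) q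

/-- **The `(𝔤, K_∞)`-complex `C^•(𝔤, K_∞; W ⊗ (E_λ(ℂ) ⊗ ε_S))`** of the space `W` of `π`
(`AutomorphicRepData.gkComplexW` of the pair `(restrictK σS, σ𝔤S)`; for a cuspidal `π` it is
`CuspidalAutomorphicRepData.gkComplexLamSign`, `gkComplexLS_eq_gkComplexLamSign`).
[cite: BorelWallach2000, I §5.1 (1)–(3)] -/
abbrev gkComplexLS :
    Literature.Algebra.Lie.ChevalleyEilenberg.Subcomplex ℝ (AutomorphyDatum.gl n K hcpt).arch.lie (Carrier π lam) :=
  π.gkComplexW (σSK hcpt S lam) (σ𝔤S hcpt lam) (σS_ad_compat S lam)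

set_option maxHeartbeats 800000 in
-- one-time identification with the tree's `gkComplexLamSign` (definitional)
/-- For a cuspidal `π`, `gkComplexLS π.1 S λ` is the tree's `π.gkComplexLamSign S λ`. [folklore] -/
theorem gkComplexLS_eq_gkComplexLamSign (π : CuspidalAutomorphicRepData n K hcpt) :
    gkComplexLS π.1 S lam = π.gkComplexLamSign S lam :=
  rfl

/-! ### Matrices as elements of `𝔤`, adelic points, twisted evaluation -/

variable (n K hcpt) in
/-- A matrix as an element of `𝔤 = 𝔤𝔩_n(K_∞)` (the Lie algebra of the `GL_n` datum is all of
`M_n(K_∞)`), `ℝ`-linearly. [folklore] -/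
def toLie : Matrix (Fin n) (Fin n) (mixedSpace K) →ₗ[ℝ] (AutomorphyDatum.gl n K hcpt).arch.lie where
  toFun Y := ⟨Y, trivial⟩
  map_add' _ _ := rfl
  map_smul' _ _ := rfl

/-- Unfolding. [folklore] -/
@[simp]
theorem coe_toLie (Y : Matrix (Fin n) (Fin n) (mixedSpace K)) :
    ((toLie n K hcpt Y : (AutomorphyDatum.gl n K hcpt).arch.lie) : Matrix (Fin n) (Fin n) (mixedSpace K)) = Y :=
  rfl

/-- Every element of `𝔤` is `toLie` of its matrix. [folklore] -/
@[simp]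
theorem toLie_coe (X : (AutomorphyDatum.gl n K hcpt).arch.lie) :
    toLie n K hcpt (X : Matrix (Fin n) (Fin n) (mixedSpace K)) = X :=
  rfl

variable (hcpt) in
/-- The adelic point `(g, c) = g_∞ · c_f ∈ GL_n(𝔸_K)` of an archimedean `g ∈ G_∞` and a finite-adelic
`c`. [cite: BorelJacquet1979, §4.1] -/
def adelicPt (g : (AutomorphyDatum.gl n K hcpt).arch.carrier) (c : BigHeckeGLn.FiniteAdelicGL n K) :
    (AdelicGroupData.gl n K).Adelic :=
  (AutomorphyDatum.gl n K hcpt).ofArch g * (show (AdelicGroupData.gl n K).Adelic from GLn.ofFinite n K c)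

/-- `g_∞` and `c_f` commute in `GL_n(𝔸_K)`. [cite: BorelJacquet1979, §4.1] -/
theorem ofArch_mul_ofFinite_comm (g : (AutomorphyDatum.gl n K hcpt).arch.carrier)
    (c : BigHeckeGLn.FiniteAdelicGL n K) :
    (AutomorphyDatum.gl n K hcpt).ofArch g * (show (AdelicGroupData.gl n K).Adelic from GLn.ofFinite n K c) =
      (show (AdelicGroupData.gl n K).Adelic from GLn.ofFinite n K c) * (AutomorphyDatum.gl n K hcpt).ofArch g :=
  (AutomorphyDatum.gl n K hcpt).commute_ofArch g _ ⟨c, rfl⟩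

/-- `(g h, c) = (g, c) · h_∞`. [folklore] -/
theorem adelicPt_mul (g h : (AutomorphyDatum.gl n K hcpt).arch.carrier) (c : BigHeckeGLn.FiniteAdelicGL n K) :
    adelicPt hcpt (g * h) c = adelicPt hcpt g c * (AutomorphyDatum.gl n K hcpt).ofArch h := by
  rw [adelicPt, adelicPt, map_mul, mul_assoc, mul_assoc, ofArch_mul_ofFinite_comm]

/-- `(g, c u) = (g, c) · u_f`. [folklore] -/
theorem adelicPt_mul_right (g : (AutomorphyDatum.gl n K hcpt).arch.carrier) (c u : BigHeckeGLn.FiniteAdelicGL n K) :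
    adelicPt hcpt g (c * u) = adelicPt hcpt g c * (show (AdelicGroupData.gl n K).Adelic from GLn.ofFinite n K u) := by
  rw [adelicPt, adelicPt, map_mul]
  exact (mul_assoc _ _ _).symm

/-- The sum of the carrier is the sum of `W ⊗ E` (the carrier is a type synonym). [folklore] -/
theorem carrier_add_eq (t t' : Carrier π lam) :
    (t + t' : Carrier π lam) =
      @id (π.W ⊗[ℂ] ResGLnCohomology.CoeffModule ℂ n K lam) t +
        @id (π.W ⊗[ℂ] ResGLnCohomology.CoeffModule ℂ n K lam) t' :=
  rfl

/-- The real scalar action of the carrier is the restriction of the complex one of `W ⊗ E`.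
[folklore] -/
theorem carrier_smul_eq (r : ℝ) (t : Carrier π lam) :
    (r • t : Carrier π lam) = (r : ℂ) • @id (π.W ⊗[ℂ] ResGLnCohomology.CoeffModule ℂ n K lam) t :=
  rfl

/-- **Twisted evaluation on `W ⊗ E`** (`ℂ`-linear): `t ↦ E(g) · t(g, c)`.
[cite: BorelWallach2000, VII 2.2] -/
def twistedEvalC (g : (AutomorphyDatum.gl n K hcpt).arch.carrier) (c : BigHeckeGLn.FiniteAdelicGL n K) :
    π.W ⊗[ℂ] ResGLnCohomology.CoeffModule ℂ n K lam →ₗ[ℂ] ResGLnCohomology.CoeffModule ℂ n K lam :=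
  (σS hcpt S lam g) ∘ₗ
    (LinearMap.proj (adelicPt hcpt g c) :
      ((AdelicGroupData.gl n K).Adelic → ResGLnCohomology.CoeffModule ℂ n K lam) →ₗ[ℂ]
        ResGLnCohomology.CoeffModule ℂ n K lam) ∘ₗ
    π.evalTensor (ResGLnCohomology.CoeffModule ℂ n K lam)

/-- Unfolding. [folklore] -/
@[simp]
theorem twistedEvalC_apply (g : (AutomorphyDatum.gl n K hcpt).arch.carrier)
    (c : BigHeckeGLn.FiniteAdelicGL n K) (t : π.W ⊗[ℂ] ResGLnCohomology.CoeffModule ℂ n K lam) :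
    twistedEvalC π S lam g c t =
      σS hcpt S lam g (π.evalTensor (ResGLnCohomology.CoeffModule ℂ n K lam) t (adelicPt hcpt g c)) :=
  rfl

/-- **Twisted evaluation** `t ↦ E(g) · t(g, c)` as an `ℝ`-linear map on the carrier of the complex
(whose real structure is the restriction of the complex one). [cite: BorelWallach2000, VII 2.2] -/
def twistedEval (g : (AutomorphyDatum.gl n K hcpt).arch.carrier) (c : BigHeckeGLn.FiniteAdelicGL n K) :
    Carrier π lam →ₗ[ℝ] ResGLnCohomology.CoeffModule ℂ n K lam where
  toFun t := twistedEvalC π S lam g c t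
  map_add' t t' := by
    rw [carrier_add_eq, map_add]
    rfl
  map_smul' r t := by
    rw [carrier_smul_eq, map_smul]
    rfl

/-- Unfolding: `twistedEval g c t = E(g) (evalTensor t (g, c))`. [folklore] -/
@[simp]
theorem twistedEval_apply (g : (AutomorphyDatum.gl n K hcpt).arch.carrier)
    (c : BigHeckeGLn.FiniteAdelicGL n K) (t : Carrier π lam) :
    twistedEval π S lam g c t =
      σS hcpt S lam g (π.evalTensor (ResGLnCohomology.CoeffModule ℂ n K lam)
        (@id (π.W ⊗[ℂ] ResGLnCohomology.CoeffModule ℂ n K lam) t) (adelicPt hcpt g c)) :=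
  rfl

/-! ### The left form, the left-trivialised form, the cone form -/

variable (η : Cochain π lam q)

/-- **The left form** (algebraic): `Y ↦ E(g) η(Y₁, …, Y_q)(g, c)` on `M_n(K_∞)`, for `g ∈ G_∞`.
[cite: BorelWallach2000, VII 2.2] -/
def leftFormAlg (c : BigHeckeGLn.FiniteAdelicGL n K) (g : (AutomorphyDatum.gl n K hcpt).arch.carrier) :
    Matrix (Fin n) (Fin n) (mixedSpace K) [⋀^Fin q]→ₗ[ℝ] ResGLnCohomology.CoeffModule ℂ n K lam :=
  (twistedEval π S lam g c).compAlternatingMap (η.compLinearMap (toLie n K hcpt))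

/-- Unfolding. [folklore] -/
@[simp]
theorem leftFormAlg_apply (c : BigHeckeGLn.FiniteAdelicGL n K)
    (g : (AutomorphyDatum.gl n K hcpt).arch.carrier) (Y : Fin q → Matrix (Fin n) (Fin n) (mixedSpace K)) :
    leftFormAlg π S lam η c g Y = twistedEval π S lam g c (η fun i => toLie n K hcpt (Y i)) :=
  rfl

/-- **The left form** at a matrix point `m` (read in `G_∞` through `GLn.archOfMatrix`, junk `1` off
the invertible matrices), as a CONTINUOUS alternating form (finite-dimensionality).
[cite: BorelWallach2000, VII 2.2] -/
def leftForm (c : BigHeckeGLn.FiniteAdelicGL n K) (m : Matrix (Fin n) (Fin n) (mixedSpace K)) :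
    Matrix (Fin n) (Fin n) (mixedSpace K) [⋀^Fin q]→L[ℝ] ResGLnCohomology.CoeffModule ℂ n K lam :=
  { leftFormAlg π S lam η c (GLn.archOfMatrix n K m) with
    cont := MultilinearMap.continuous_of_finiteDimensional_fin
      (leftFormAlg π S lam η c (GLn.archOfMatrix n K m)).toMultilinearMap }

/-- Unfolding. [folklore] -/
@[simp]
theorem leftForm_apply (c : BigHeckeGLn.FiniteAdelicGL n K) (m : Matrix (Fin n) (Fin n) (mixedSpace K))
    (Y : Fin q → Matrix (Fin n) (Fin n) (mixedSpace K)) :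
    leftForm π S lam η c m Y = leftFormAlg π S lam η c (GLn.archOfMatrix n K m) Y :=
  rfl

/-- **The left-trivialised form** `ω̃(m)(Y₁, …, Y_q) = E(m) η(m⁻¹Y₁, …, m⁻¹Y_q)(m, c)`
(`Ring.inverse m`, junk off the invertible matrices). [cite: BorelWallach2000, VII 2.2] -/
def leftTrivForm (c : BigHeckeGLn.FiniteAdelicGL n K) (m : Matrix (Fin n) (Fin n) (mixedSpace K)) :
    Matrix (Fin n) (Fin n) (mixedSpace K) [⋀^Fin q]→L[ℝ] ResGLnCohomology.CoeffModule ℂ n K lam :=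
  (leftForm π S lam η c m).compContinuousLinearMap
    (ContinuousLinearMap.mul ℝ (Matrix (Fin n) (Fin n) (mixedSpace K)) (Ring.inverse m))

/-- Unfolding. [folklore] -/
@[simp]
theorem leftTrivForm_apply (c : BigHeckeGLn.FiniteAdelicGL n K)
    (m : Matrix (Fin n) (Fin n) (mixedSpace K)) (Y : Fin q → Matrix (Fin n) (Fin n) (mixedSpace K)) :
    leftTrivForm π S lam η c m Y = leftForm π S lam η c m fun i => Ring.inverse m * Y i :=
  rfl

/-- The left-trivialised form is the function `m ↦ leftForm m ∘ ∧^q (m⁻¹ ·)` — the shape of the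
Maurer–Cartan identity. [folklore] -/
theorem leftTrivForm_eq (c : BigHeckeGLn.FiniteAdelicGL n K) :
    leftTrivForm π S lam η c = fun m => (leftForm π S lam η c m).compContinuousLinearMap
      (ContinuousLinearMap.mul ℝ (Matrix (Fin n) (Fin n) (mixedSpace K)) (Ring.inverse m)) :=
  rfl

variable (n K) in
/-- A global section of the hermitian square `g ↦ g gᴴ` over its image (an invertible `g` with
`g gᴴ = H` when there is one, else `1`); only its EXISTENCE is used — every formula below holds for
every section. [folklore] -/
def sec (H : ResGLnCone.hermSpace n K) : Matrix (Fin n) (Fin n) (mixedSpace K) :=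
  if h : ∃ g : Matrix (Fin n) (Fin n) (mixedSpace K), IsUnit g ∧ g * gᴴ = (H : Matrix (Fin n) (Fin n) (mixedSpace K))
  then h.choose else 1

omit [NumberField K] in
/-- When `H = g gᴴ` for some invertible `g`, the section `sec H` is invertible and squares to `H`.
[folklore] -/
theorem sec_spec {H : ResGLnCone.hermSpace n K}
    (h : ∃ g : Matrix (Fin n) (Fin n) (mixedSpace K), IsUnit g ∧ g * gᴴ = (H : Matrix (Fin n) (Fin n) (mixedSpace K))) :
    IsUnit (sec n K H) ∧ sec n K H * (sec n K H)ᴴ = (H : Matrix (Fin n) (Fin n) (mixedSpace K)) := by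
  rw [sec, dif_pos h]
  exact h.choose_spec

variable (n K) in
/-- The right inverse `v ↦ ½ v g⁻ᴴ` of the differential `Y ↦ Y gᴴ + g Yᴴ` of the hermitian square at
an invertible `g`, on the hermitian space (`(½ v g⁻ᴴ) gᴴ + g (½ v g⁻ᴴ)ᴴ = v` for `vᴴ = v`).
[folklore] -/
def halfRight (g : Matrix (Fin n) (Fin n) (mixedSpace K)) :
    ResGLnCone.hermSpace n K →L[ℝ] Matrix (Fin n) (Fin n) (mixedSpace K) :=
  LinearMap.toContinuousLinearMap
    (((1 / 2 : ℝ) • LinearMap.mulRight ℝ (Ring.inverse g)ᴴ) ∘ₗ (ResGLnCone.hermSpace n K).subtype)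

/-- Unfolding: `halfRight g v = ½ v g⁻ᴴ`. [folklore] -/
@[simp]
theorem halfRight_apply (g : Matrix (Fin n) (Fin n) (mixedSpace K)) (v : ResGLnCone.hermSpace n K) :
    halfRight n K g v = (1 / 2 : ℝ) • ((v : Matrix (Fin n) (Fin n) (mixedSpace K)) * (Ring.inverse g)ᴴ) :=
  rfl

/-- **The cone form** `ω_c(H)(v₁, …, v_q) = ω̃(g)(½ v₁ g⁻ᴴ, …, ½ v_q g⁻ᴴ)` with `g = sec H`: the
`E_λ(ℂ)`-valued `q`-form on the hermitian space attached to the cochain `η` and the finite-adelic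
point `c`. [cite: BorelWallach2000, VII 2.2–2.5] -/
def coneForm (c : BigHeckeGLn.FiniteAdelicGL n K) (H : ResGLnCone.hermSpace n K) :
    ResGLnCone.hermSpace n K [⋀^Fin q]→L[ℝ] ResGLnCohomology.CoeffModule ℂ n K lam :=
  (leftTrivForm π S lam η c (sec n K H)).compContinuousLinearMap (halfRight n K (sec n K H))

/-- Unfolding. [folklore] -/
theorem coneForm_apply (c : BigHeckeGLn.FiniteAdelicGL n K) (H : ResGLnCone.hermSpace n K)
    (v : Fin q → ResGLnCone.hermSpace n K) :
    coneForm π S lam η c H v = leftTrivForm π S lam η c (sec n K H) fun i => halfRight n K (sec n K H) (v i) :=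
  rfl

/-! ### Consequences of membership in the `(𝔤, K_∞)`-complex -/

/-- **`𝔨`-relativity**: a cochain of the `(𝔤, K_∞)`-complex vanishes as soon as one argument is
skew-hermitian (`i_X η = 0` for `X ∈ 𝔨`, moved to the front by alternation).
[cite: BorelWallach2000, I §5.1 (2)] -/
theorem apply_eq_zero_of_skew {q : ℕ} {η : Cochain π lam (q + 1)}
    (hη : η ∈ (gkComplexLS π S lam).carrier (q + 1)) (v : Fin (q + 1) → (AutomorphyDatum.gl n K hcpt).arch.lie)
    (i : Fin (q + 1))
    (hv : star ((v i : (AutomorphyDatum.gl n K hcpt).arch.lie) : Matrix (Fin n) (Fin n) (mixedSpace K)) =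
      -((v i : (AutomorphyDatum.gl n K hcpt).arch.lie) : Matrix (Fin n) (Fin n) (mixedSpace K))) :
    η v = 0 := by
  have hrel := ((mem_gkComplex_succ_iff (AutomorphyDatum.gl n K hcpt).arch _ _ _ q η).1 hη).1
  -- a cochain of the complex vanishes when its FIRST argument is skew-hermitian
  have key : ∀ w : Fin (q + 1) → (AutomorphyDatum.gl n K hcpt).arch.lie,
      star ((w 0 : (AutomorphyDatum.gl n K hcpt).arch.lie) : Matrix (Fin n) (Fin n) (mixedSpace K)) =
        -((w 0 : (AutomorphyDatum.gl n K hcpt).arch.lie) : Matrix (Fin n) (Fin n) (mixedSpace K)) →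
      η w = 0 := by
    intro w hw
    have hmem : w 0 ∈ (AutomorphyDatum.gl n K hcpt).arch.kInLie :=
      ((AutomorphyDatum.gl n K hcpt).arch.mem_kInLie_iff _).2
        (((AutomorphyDatum.gl n K hcpt).arch.mem_compactLie_iff _).2 ⟨(w 0).2, hw⟩)
    have h0 : η (Matrix.vecCons (w 0) (Fin.tail w)) = 0 :=
      congrArg (fun f => f (Fin.tail w)) ((hrel (w 0) hmem).2)
    rwa [show Matrix.vecCons (w 0) (Fin.tail w) = w from Fin.cons_self_tail w] at h0
  by_cases hi : i = 0
  · subst hi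
    exact key v hv
  · have hsw := AlternatingMap.map_swap η v (Ne.symm hi)
    have h0 : η (v ∘ Equiv.swap 0 i) = 0 := key _ (by simpa using hv)
    rw [h0] at hsw
    exact neg_eq_zero.1 hsw.symm

/-- `(g k, c) · k⁻¹ = (g, c)` in `GL_n(𝔸_K)` for `k ∈ K_∞`. [folklore] -/
theorem adelicPt_mul_inclusion_mul_ofK_inv (g : (AutomorphyDatum.gl n K hcpt).arch.carrier)
    (k : (AutomorphyDatum.gl n K hcpt).arch.maximalCompact) (c : BigHeckeGLn.FiniteAdelicGL n K) :
    adelicPt hcpt (g * Subgroup.inclusion (AutomorphyDatum.gl n K hcpt).arch.maximalCompact_le_carrier k) c *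
        (AutomorphyDatum.gl n K hcpt).ofK k⁻¹ =
      adelicPt hcpt g c := by
  rw [adelicPt_mul, AutomorphyDatum.ofK_apply, mul_assoc, ← map_mul, ← map_mul, mul_inv_cancel, map_one,
    map_one, mul_one]

set_option maxHeartbeats 800000 in
-- `σSK` is an abbrev tower over the datum
/-- `E(g k) E(k⁻¹) = E(g)` on `E_λ(ℂ) ⊗ ε_S`. [folklore] -/
theorem σS_mul_inclusion_σSK_inv (g : (AutomorphyDatum.gl n K hcpt).arch.carrier)
    (k : (AutomorphyDatum.gl n K hcpt).arch.maximalCompact) (y : ResGLnCohomology.CoeffModule ℂ n K lam) :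
    σS hcpt S lam (g * Subgroup.inclusion (AutomorphyDatum.gl n K hcpt).arch.maximalCompact_le_carrier k)
        (σSK hcpt S lam k⁻¹ y) =
      σS hcpt S lam g y := by
  change σS hcpt S lam (g * Subgroup.inclusion (AutomorphyDatum.gl n K hcpt).arch.maximalCompact_le_carrier k)
    (σS hcpt S lam (Subgroup.inclusion (AutomorphyDatum.gl n K hcpt).arch.maximalCompact_le_carrier k⁻¹) y) = _
  rw [← Module.End.mul_apply, ← map_mul, map_inv, mul_inv_cancel_right]

set_option maxHeartbeats 800000 in
-- `σSK` is an abbrev tower over the datum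
/-- `evalTensor ((r(k) ⊗ E(k)) t) x = E(k) (evalTensor t (x k))` for the coefficients `E_λ(ℂ) ⊗ ε_S`
(`AutomorphicRepData.evalTensor_tprod_kRepW`). [cite: BorelWallach2000, I §5.1] -/
theorem evalTensor_tprod_σSK (k : (AutomorphyDatum.gl n K hcpt).arch.maximalCompact)
    (t : π.W ⊗[ℂ] ResGLnCohomology.CoeffModule ℂ n K lam) (x : (AdelicGroupData.gl n K).Adelic) :
    π.evalTensor (ResGLnCohomology.CoeffModule ℂ n K lam) ((π.kRepW.tprod (σSK hcpt S lam)) k t) x =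
      σSK hcpt S lam k (π.evalTensor (ResGLnCohomology.CoeffModule ℂ n K lam) t
        (x * (AutomorphyDatum.gl n K hcpt).ofK k)) :=
  AutomorphicRepData.evalTensor_tprod_kRepW π (σSK hcpt S lam) k t x

set_option maxHeartbeats 800000 in
-- the fixedness hypothesis of the complex is unfolded through the abbrev towers over the datum
/-- **`K_∞`-fixedness**: for a cochain of the `(𝔤, K_∞)`-complex, `k ∈ K_∞` and `g ∈ G_∞`,
`E(g k) · η(Ad(k⁻¹) X₁, …)(g k, c) = E(g) · η(X₁, …)(g, c)` — the twisted evaluation of `η` is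
invariant under `(g, X) ↦ (g k, Ad(k⁻¹) X)`; this is what makes the cone form independent of the
chosen square root `g` of `H = g gᴴ`. [cite: BorelWallach2000, I §5.1 (3)] -/
theorem twistedEval_mul_inclusion {q : ℕ} {η : Cochain π lam (q + 1)}
    (hη : η ∈ (gkComplexLS π S lam).carrier (q + 1)) (g : (AutomorphyDatum.gl n K hcpt).arch.carrier)
    (k : (AutomorphyDatum.gl n K hcpt).arch.maximalCompact) (c : BigHeckeGLn.FiniteAdelicGL n K)
    (v : Fin (q + 1) → (AutomorphyDatum.gl n K hcpt).arch.lie) :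
    twistedEval π S lam (g * Subgroup.inclusion (AutomorphyDatum.gl n K hcpt).arch.maximalCompact_le_carrier k) c
        (η fun i => (AutomorphyDatum.gl n K hcpt).arch.Ad
          (Subgroup.inclusion (AutomorphyDatum.gl n K hcpt).arch.maximalCompact_le_carrier k⁻¹) (v i)) =
      twistedEval π S lam g c (η v) := by
  have hfix := ((mem_gkComplex_succ_iff (AutomorphyDatum.gl n K hcpt).arch _ _ _ q η).1 hη).2 k
  -- fixedness under `k`: `(r(k) ⊗ E(k)) (η (Ad(k⁻¹) v)) = η v`
  have hk : (π.kRepW.tprod (σSK hcpt S lam)) k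
      (@id (π.W ⊗[ℂ] ResGLnCohomology.CoeffModule ℂ n K lam)
        (η fun i => (AutomorphyDatum.gl n K hcpt).arch.Ad
          (Subgroup.inclusion (AutomorphyDatum.gl n K hcpt).arch.maximalCompact_le_carrier k⁻¹) (v i))) =
      @id (π.W ⊗[ℂ] ResGLnCohomology.CoeffModule ℂ n K lam) (η v) := by
    have hk0 := congrArg (fun f => f v) hfix
    rw [Literature.Algebra.Lie.ChevalleyEilenberg.PairAction.act_apply] at hk0
    exact hk0
  have hk' : @id (π.W ⊗[ℂ] ResGLnCohomology.CoeffModule ℂ n K lam)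
        (η fun i => (AutomorphyDatum.gl n K hcpt).arch.Ad
          (Subgroup.inclusion (AutomorphyDatum.gl n K hcpt).arch.maximalCompact_le_carrier k⁻¹) (v i)) =
      (π.kRepW.tprod (σSK hcpt S lam)) k⁻¹
        (@id (π.W ⊗[ℂ] ResGLnCohomology.CoeffModule ℂ n K lam) (η v)) := by
    rw [← hk, ← Module.End.mul_apply, ← map_mul, inv_mul_cancel, map_one, Module.End.one_apply]
  calc twistedEval π S lam (g * Subgroup.inclusion (AutomorphyDatum.gl n K hcpt).arch.maximalCompact_le_carrier k) c
          (η fun i => (AutomorphyDatum.gl n K hcpt).arch.Ad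
            (Subgroup.inclusion (AutomorphyDatum.gl n K hcpt).arch.maximalCompact_le_carrier k⁻¹) (v i))
      = σS hcpt S lam (g * Subgroup.inclusion (AutomorphyDatum.gl n K hcpt).arch.maximalCompact_le_carrier k)
          (π.evalTensor (ResGLnCohomology.CoeffModule ℂ n K lam)
            ((π.kRepW.tprod (σSK hcpt S lam)) k⁻¹ (@id (π.W ⊗[ℂ] ResGLnCohomology.CoeffModule ℂ n K lam) (η v)))
            (adelicPt hcpt (g * Subgroup.inclusion (AutomorphyDatum.gl n K hcpt).arch.maximalCompact_le_carrier k) c)) :=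
        congrArg (fun t => σS hcpt S lam
          (g * Subgroup.inclusion (AutomorphyDatum.gl n K hcpt).arch.maximalCompact_le_carrier k)
          (π.evalTensor (ResGLnCohomology.CoeffModule ℂ n K lam) t
            (adelicPt hcpt (g * Subgroup.inclusion (AutomorphyDatum.gl n K hcpt).arch.maximalCompact_le_carrier k) c))) hk'
    _ = σS hcpt S lam (g * Subgroup.inclusion (AutomorphyDatum.gl n K hcpt).arch.maximalCompact_le_carrier k)
          (σSK hcpt S lam k⁻¹ (π.evalTensor (ResGLnCohomology.CoeffModule ℂ n K lam)
            (@id (π.W ⊗[ℂ] ResGLnCohomology.CoeffModule ℂ n K lam) (η v))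
            (adelicPt hcpt (g * Subgroup.inclusion (AutomorphyDatum.gl n K hcpt).arch.maximalCompact_le_carrier k) c *
              (AutomorphyDatum.gl n K hcpt).ofK k⁻¹))) :=
        congrArg (σS hcpt S lam (g * Subgroup.inclusion (AutomorphyDatum.gl n K hcpt).arch.maximalCompact_le_carrier k))
          (evalTensor_tprod_σSK π S lam k⁻¹ _ _)
    _ = σS hcpt S lam g (π.evalTensor (ResGLnCohomology.CoeffModule ℂ n K lam)
            (@id (π.W ⊗[ℂ] ResGLnCohomology.CoeffModule ℂ n K lam) (η v)) (adelicPt hcpt g c)) := by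
        rw [adelicPt_mul_inclusion_mul_ofK_inv, σS_mul_inclusion_σSK_inv]

/-- **The left form only sees the hermitian parts of its arguments**: changing one argument by a
skew-hermitian matrix does not change `E(g) η(Y₁, …)(g, c)` (multilinearity and `𝔨`-relativity).
[cite: BorelWallach2000, I §5.1 (2), VII 2.2] -/
theorem leftFormAlg_update_add_skew {q : ℕ} {η : Cochain π lam (q + 1)}
    (hη : η ∈ (gkComplexLS π S lam).carrier (q + 1)) (c : BigHeckeGLn.FiniteAdelicGL n K)
    (g : (AutomorphyDatum.gl n K hcpt).arch.carrier) (Y : Fin (q + 1) → Matrix (Fin n) (Fin n) (mixedSpace K))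
    (i : Fin (q + 1)) {Z : Matrix (Fin n) (Fin n) (mixedSpace K)} (hZ : star Z = -Z) :
    leftFormAlg π S lam η c g (Function.update Y i (Y i + Z)) = leftFormAlg π S lam η c g Y := by
  rw [leftFormAlg_apply, leftFormAlg_apply]
  have hfun : (fun j => toLie n K hcpt (Function.update Y i (Y i + Z) j)) =
      Function.update (fun j => toLie n K hcpt (Y j)) i (toLie n K hcpt (Y i) + toLie n K hcpt Z) := by
    funext j
    by_cases hj : j = i
    · subst hj
      rw [Function.update_self, Function.update_self, map_add]
    · rw [Function.update_of_ne hj, Function.update_of_ne hj]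
  rw [hfun, η.map_update_add]
  have hzero : η (Function.update (fun j => toLie n K hcpt (Y j)) i (toLie n K hcpt Z)) = 0 :=
    apply_eq_zero_of_skew π S lam hη _ i (by rw [Function.update_self]; exact hZ)
  rw [hzero, add_zero, Function.update_eq_self]

/-- **`K_∞`-invariance of the left form**: `E(g k) η(k⁻¹Y₁k, …)(g k, c) = E(g) η(Y₁, …)(g, c)` for
`k ∈ K_∞`. [cite: BorelWallach2000, I §5.1 (3), VII 2.2] -/
theorem leftFormAlg_mul_inclusion {q : ℕ} {η : Cochain π lam (q + 1)}
    (hη : η ∈ (gkComplexLS π S lam).carrier (q + 1)) (c : BigHeckeGLn.FiniteAdelicGL n K)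
    (g : (AutomorphyDatum.gl n K hcpt).arch.carrier) (k : (AutomorphyDatum.gl n K hcpt).arch.maximalCompact)
    (Y : Fin (q + 1) → Matrix (Fin n) (Fin n) (mixedSpace K)) :
    leftFormAlg π S lam η c (g * Subgroup.inclusion (AutomorphyDatum.gl n K hcpt).arch.maximalCompact_le_carrier k)
        (fun i => (((k⁻¹ : (AutomorphyDatum.gl n K hcpt).arch.maximalCompact) : GL (Fin n) (mixedSpace K)) :
          Matrix (Fin n) (Fin n) (mixedSpace K)) * Y i *
          (((k : (AutomorphyDatum.gl n K hcpt).arch.maximalCompact) : GL (Fin n) (mixedSpace K)) :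
            Matrix (Fin n) (Fin n) (mixedSpace K))) =
      leftFormAlg π S lam η c g Y := by
  rw [leftFormAlg_apply, leftFormAlg_apply, ← twistedEval_mul_inclusion π S lam hη g k c]
  rfl

end ConeDictionary

end Literature.NumberTheory.Automorphic

end
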